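import Summits.QuantumFields.BalabanUV.T4Continuum.Support.ShellMeasureLandauEndAssembledDecayCfLinCoTestsSchurCoarseV6ReadOuts
import Summits.QuantumFields.BalabanUV.T4Continuum.Support.ShellMeasureThresholdUnits

/-!
# `T4Continuum.ShellMeasureLiveEndOneCallSlotLevelsCfLinJunctionV6` — row S115 file 1⁷: THE LIVE-LEVEL END-II AFTER THE LAST HOST CHAIN (v6: the
# chain-end host `ShellMeasureLandauEndAssembledDecayCfLinCoTestsSchurCoarseV6ReadOuts` ∘ the γ8 unit change S90) OVER THE INDEXED,
# LEVEL-LIFTED FAMILIES, for BOTH runs and every slot — END-I's `hacA`∕`hacB` shape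
(cell `pub-balaban`, sub-cell `t4`, spine estimate NE7c (node U5b); NE7c ROUND-2 crew, unit `b2b-balaban-t4-ne7c-formalise-leaf-09`
gen 15; owner table `t4/b2b-balaban-t4-ne7c-p1/LEAVES-NE7c-P1.md` row **S115** «THE ONE CALL v6 — THE LAST HOST CHAIN COLLECTED»
(R-ne7cp1-g37-1 (c5), booked to the leaf-09 lineage; pre-validated over the staged chain by leaf-09-g14, journal l.23496); ADDITIVE —
imports the chain-end host `ShellMeasureLandauEndAssembledDecayCfLinCoTestsSchurCoarseV6ReadOuts` and S90 `ShellMeasureThresholdUnits` ONLY;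
[folklore]; 0 `def`, 0 `def … : Prop`, 0 sorry, 0 citation tags; the statement is GENERATED from the host's signature by the
S92∕S95∕S102∕S105∕S107∕S111 script re-pointed — `HOME/b2b-balaban-t4-ne7c-formalise-leaf-09/g15/s115v6/`)

HONEST FRAMING.  Finite four-torus programme, rung (B)+1 only — NOT infinite volume, NOT a mass gap, NOT the Clay problem, NOT
summit progress; (B), `BetaPertHyp`, (B^μ) not consumed.  NE7c (`T4IndicatorShell.ShellWeightBound`) is NOT PRINTED in
[Balaban 1983–89] and NOT PROVED; «NE7c ⇐ the named binders» (trigger c3): every binder below is DISPLAYED, asserted by nobody;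
no estimate of Bałaban's is discharged; (M1) realized ≠ NE7c.  Equation numbers in comments LOCATE displayed shapes, not
citations.  HONEST DEPENDENCY (cell): continuum YM on T⁴ ⇐ BetaPertH ∧ nine spine estimates (0/9 proved); BetaPertH ⇐ (D1) ∧ (D4)
∧ CAP+tail; G-an2-4 gates asym, D1 and NE2/3/4.

THE LAST HOST CHAIN = v6 (owner R-ne7cp1-g37-1: the v5 host re-rooted on S112's field-size contraction budgets and S113's
𝓔-leg-as-the-w-tuple's-pinned-dress, the middle re-linked mechanically, the top re-fired; then ONE re-fire of THE ONE CALL — this row (c5); AFTER IT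
THE ONE CALL IS FROZEN (d)). The chain as landed: (R) S112 f3 = S80 f3′ `ShellMeasureLandauEndRayStokesAssembledDecayV6` (author leaf-07-g10,
courier leaf-03-g9, p242676) → (1) S80 f5′ `ShellMeasureLandauEndAssembledDecayReachV6` (p243641) → (2) S80 f6′
`ShellMeasureLandauEndAssembledDecayReachBoxV6` (p245638) → (3) S99 f3b′ `ShellMeasureLandauEndAssembledDecayCfV6` (p245923) → (4) S104 f2′
`ShellMeasureLandauEndAssembledDecayCfLinV6` (p246294) → (5) S104 f4′ `ShellMeasureLandauEndAssembledDecayCfLinCoTestsV6` (p246541) → (6) S108 f2′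
`ShellMeasureLandauEndAssembledDecayCfLinCoTestsSchurV6` (p246602) → (7) S108 f3′ `ShellMeasureLandauEndAssembledDecayCfLinCoTestsSchurElbV6`
(p246736) → (8) S110′ `ShellMeasureLandauEndAssembledDecayCfLinCoTestsSchurCoarseV6` (p246871) (the MIDDLE: author leaf-03-g9, `relink.py`; links
2–8 filed UNCHANGED by courier leaf-08-g17 (R-ne7cp1-g37-10 (a) ∕ -14 (a) ∕ -16; leaf-09-g15 standing fallback)) → (T) S109 f2′
`ShellMeasureLandauEndAssembledDecayCfLinCoTestsSchurCoarseV6ReadOuts` (leaf-08-g17, p247144). Binder movements, mechanically (my `typediff.py` on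
the bytes — top-level binder NAMES and normalised TYPES; the links' own headers, leaf-03-g9's `linkdiffs.txt` and leaf-05-g12's independent
`binderdiff.py` (C-ne7cL05g12-1) agree name for name): AT THE ROOT (vs S80 f3 `ShellMeasureLandauEndRayStokesAssembledDecay`): LEAVING (33) the
𝓔-leg's scheme tuple `Λe 𝔄 δ′ ϖ hδ′ hϖ 𝒴e′ 𝒳e 𝒵e ℬe 𝒢e W𝒱e B₀e C₄e a₃e be h𝒢e hWe hB₀e hC₄e hbe H₁e hH₁e Φe rΦe hΦde hΦ0e hΦbe hSre ιe hιe He hHe`,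
ENTERING (5) `hϖ0 hB𝒢w hBH₁w hBHw hιew`, TYPE-CHANGED (18) `hqW hk hdome hselfe hcontre Ce hCqe hqe hRCe Ef hEb supp hblind hdepth hK hcoupE hElb₁
hRdict` — `hqW hk` = the Wilson slot's two contraction budgets RE-SHAPED into print's FIELD-SIZE form ([Balaban1985Variational] p. 286 (53)–(54)
«contractive if 9C₂B₀ε₃ < 1» TYPE: `2C₄w·a₃w ↦ 4C₄w·(ε₄w + B₀w·bw)`, `2C2cov·landauRad ↦ 12C2cov·(ε₄w + B₀w·bw)`; S112 f2
`ShellMeasureLandauWilsonSquaresKernelsSchwarzField` p239911; v4∕v5's `hk` was UNINHABITABLE by the designed `H` — leaf-06-g9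
`ShellMeasureLandauPinnedBudget.not_hk_of_designed` — and the re-shaped pair is jointly INHABITED at designed sizes — leaf-04-g12
`ShellMeasureLandauPinnedBudgetDesigned` p240841), the other sixteen = the 𝓔-leg's rows RE-LETTERED at the w-tuple's instances (S113 f2
`ShellMeasureRayTermsPinnedLandauW.hE_landau_chartRay_pinned_w` p240753: the (T3) tuple IS the (T2) w-tuple in S69's pinned dress — ONE term of B14
(2.18), ONE exponent field); IN THE MIDDLE (leaf-03-g9's `relink.py`: each link = the OLD link's surgery re-applied over the new predecessor, ONE
by-name call, conclusion = the predecessor's; LEAVE∕ENTER∕TYPE-CHANGED vs the OLD link = the root's sets carried down, less what the old links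
consume themselves): from link (3) the f3b-era e-reach data `Se Se′ h52loce ϖe₁ ϖe₂ hϖe₁ hϖe₂ r₀e hreache` NEVER ENTER and `Ce hCqe` are
INSTANTIATED (hand-spot: the 𝓔-leg's pinned Landau pair := the w-tuple's box-local pair `hRw` through its own pins,
`ShellMeasureLandauCfPinned.conj_binders_of_local`); from link (4) the chart map is R10's linear `Tw` (`Te hTbe` replace `Φe hΦde hΦ0e hΦbe` in the
LEAVING set); from link (6) on `hB𝒢w hBH₁w hBHw` are no longer NEW (the OLD Schur link S108 f2 had introduced these number junctions; in v6 they are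
bound from the ROOT and serve BOTH S113's 𝓔-leg call and S108 f1's Schur fold — they STAY displayed to the top); at link (7) `hElb₁` is DERIVED per
exterior section (S113 f2 `hElb_landau_chartRay_pinned_w` ∘ S108 f3a; hand-spot); at link (8) the coarse-blocked reading instantiates S113's pin
occurrences (`ϖw := pinDist Bref`, `dis := pl1`) and DISCHARGES the sign row `hϖ0` by S69 `pinDist_nonneg` (hand-spot); AT THE TOP (leaf-08-g17's
`gen_f2.py` over link (8), option (B) of R-ne7cp1-g37-5: the carrier algebra `𝔸` abstract, S114 `ShellMeasureReadOutsRestrict` p240850 standalone —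
`ιs hι hιr` stay displayed). NET, v5's chain-end host `ShellMeasureLandauEndAssembledDecayCfLinCoTestsSchurCoarseReadOuts` (p240165) → the v6 top:
explicit 232 → 207, implicit 102 → 90, instances 26 → 18 (the e-carriers' eight structure instances leave); LEAVING (38) `Se Se′ h52loce ϖe₁ ϖe₂
hϖe₁ hϖe₂ r₀e hreache Λe 𝔄 δ′ ϖ hδ′ hϖ 𝒵e ℬe 𝒢e W𝒱e B₀e C₄e a₃e be h𝒢e hWe hB₀e hC₄e hbe H₁e hH₁e Te rΦe hTbe hSre ιe hιe He hHe`; ENTERING (1)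
`hιew` (the reach of the w-tuple's `ι`-kernel read by the 𝓔-leg, S113); TYPE-CHANGED (15) `hqW hk hdome hselfe hcontre hqe hRCe Ef hEb supp hblind
hdepth hK hcoupE hRdict`; conclusion = v5's with the slot constant's two Wilson factors re-spelled and the non-Wilson summand's pinned variation `z̄
= (ε₄e + B₀w·bw) + B₀w·(4C₂e(ε₄e + B₀w·bw)²)` in w-letters. Every LEAVING row is a DUPLICATE of a w-row under the one-exponent-field reading, or a
sign ∕ derived row; the two RE-SHAPED rows are print's field-size form of the same two budgets; NOTHING of Bałaban's is discharged — the CONTENT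
rows (propagator ∕ (P4) ∕ linear maps, decay kernels, sectioned non-Wilson terms, the located background regularity, the neighbours' (AN-bound))
stay displayed, asserted by nobody.

WHAT IS PROVED ([folklore]). **`hac_live_of_assembled_decay_levels_cfB7_lin_junction_v6`**: for a run index `r : Bool`, comparison index `K`, source
parameter `t` and slot `s : σ`, with the slot on its own lattice `(P r K s, jl r K s)` (lattice level `jl`; END-I level `lvl`), EVERY binder of the
chain-end host `slotAC_realized_su2_landauChart_assembled_decay_v6_cfB7_lin_coTests_schur_elb_coarse_readOuts` as a FAMILY — the TYPE families and
the box ∕ chart ∕ coarse-torus geometry (`lo hi nb Λ m₀ e`, the level `k`, the B7 index sets `Sf Sf′ Sw Sw′`, the cells-per-direction `Nc` where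
bound) by `(r, K, s)`, every other object by `(r, K, t, s)`, hypotheses quantified unguarded over exactly the indices they mention; Bałaban's
UNIFORM NUMBERS SHARED across runs and slots; the η-scaled numbers `κwb κcb dbar Kw : Bool → ℕ → ℝ` read at the slot's LATTICE level (S95's LIFT
RULE); the profiles `ε η ρ β : Bool → ℕ → ℝ` ⟹ `∀ r K t s, SlotAntiConcentration ((fieldMeasure (P r K s) (jl r K s) SU2).withDensity (F r K t s))
(u r K t s ∕ η r (jl r K s)²) (ε r (K − lvl r K s)) (ρ r (lvl r K s)) (the host's slot constant at (r, K, t, s))` — ONE call of the host at `(εθ, η)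
:= (ε r (K − lvl r K s), η r (jl r K s))`, then S90 `slotAntiConcentration_thresholdUnits`. Renamings forced by END-I's names (as since S92):
classifier index type `ιc`, S78's exponent `Aex`, (SM) letter `zs`, the linear chart map `TΦ` (the e-reach and its bound variable are GONE with the
e-tuple).
-/

noncomputable section

open Set Metric NormedSpace MeasureTheory Function Finset
open scoped ENNReal

namespace Summit.QuantumFields.BalabanUV.T4Continuum.ShellMeasureLiveEndOneCallSlotLevelsCfLinJunctionV6

open Literature.MathematicalPhysics.QuantumFieldTheory.Balaban1983to89
open B11Prop6Scheme (Prop4Hyp)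
open GaugeField (GaugeInvariant)
open T4ShellMeasure (SlotAntiConcentration)
open T4CubePoincare (cube)
open T4CubeChartGnomonic (SU2)
open T4CubeChartExp (expFibreChart)
open T4TreeGaugeFixing (NoClosedLoop fixTo)
open T4ShellMeasurePlaquette (expTail₂)
open ShellMeasureLevelAssembly (classifier)
open ShellMeasureMultiGridNorms (WSup)
open ShellMeasurePinnedNorm (pinW)
open ShellMeasureDecayKernelSums (kerOp)
open ShellMeasureLandauHolonomy (solAt landauExp)
open ShellMeasureLandauHolonomyChart (holOf cplx)
open ShellMeasureLandauHolonomySkew (readOutReal)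
open ShellMeasureMultiGridNorms.WSup (toPiL)
open T4AxialGaugeSmallField (boxPlaqs boxBonds)
open T4AxialGaugeFixing (combBonds)
open B7Prop2Explicit (C0 c2' unitaryUnits)
open B7Prop1Local (pdevOn loK bondHiK)
open B7Prop5Flat (BondIn)
open ShellMeasureAverageProp4General (O1cov C2cov)
open ShellMeasureLandauCorrectionB7 (landauCf landauRad)
open ShellMeasureLandauCorrectionReal (skewPi)
open ShellMeasureLandauCfBoxLocal (landauCfBox)
open ShellMeasureThresholdUnits (slotAntiConcentration_thresholdUnits)
open ShellMeasureLandauEndAssembledDecayCfLinCoTestsSchurCoarseV6ReadOuts (slotAC_realized_su2_landauChart_assembled_decay_v6_cfB7_lin_coTests_schur_elb_coarse_readOuts)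

open TreeLengthTorus (TPt)
open B12Decay510Torus (pl1)
open ShellMeasurePinnedNorm (pinDist kerOpPin)
open ShellMeasureCommutatorCovDatum (covIdx covD)
open B7Prop1Explicit (U1)
open ShellMeasureReadOutsMax (Ysp plaqReadOuts)
open scoped Matrix.Norms.L2Operator

variable {σ : Type*} {n : Type*} [Fintype n] [DecidableEq n] [Nonempty n]

/-- **THE LIVE-LEVEL END-II AFTER THE LAST HOST CHAIN (v6), IN THRESHOLD UNITS, OVER THE INDEXED FAMILIES** (row S115 file 1⁷; see
the module docstring).  CONDITIONAL on every displayed binder; nothing PRINTED is asserted; NOT Bałaban's minimiser; NE7c NOT PROVED. [folklore] -/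
theorem hac_live_of_assembled_decay_levels_cfB7_lin_junction_v6
    (P : Bool → ℕ → σ → Params) (jl lvl : Bool → ℕ → σ → ℕ) [∀ r K s, DecidableEq (PBond (P r K s) (jl r K s))]
    {ε η ρ β : Bool → ℕ → ℝ} (hη : ∀ r j, 0 < η r j) (hε : ∀ r a, 0 < ε r a) (hρ0 : ∀ r j, 0 ≤ ρ r j)
    {𝒵 ℬ : Bool → ℕ → σ → Type*} [∀ r K s, NormedAddCommGroup (𝒵 r K s)] [∀ r K s, NormedSpace ℂ (𝒵 r K s)] [∀ r K s, NormedAddCommGroup (ℬ r K s)]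
    [∀ r K s, NormedSpace ℂ (ℬ r K s)] {𝔸 : Bool → ℕ → σ → Type*} [∀ r K s, CStarAlgebra (𝔸 r K s)] [∀ r K s, Nontrivial (𝔸 r K s)]
    {lo hi : ∀ r K s, Fin (P r K s).d → ℤ} {nb : Bool → ℕ → σ → ℕ} (hn : ∀ r K s, ∀ κ, hi r K s κ ≤ lo r K s κ + nb r K s)
    (hN : ∀ r K s, ∀ κ, hi r K s κ - lo r K s κ < (P r K s).sitesPerDir (jl r K s)) (Λ : ∀ r K s, Finset (PBond (P r K s) (jl r K s)))
    (hΛbox : ∀ r K s, ∀ b ∈ Λ r K s, b ∈ boxBonds (lo r K s) (hi r K s)) (hΛcomb : ∀ r K s, Disjoint (Λ r K s) (combBonds (lo r K s) (hi r K s)))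
    {m₀ : Bool → ℕ → σ → ℕ} (e : ∀ r K s, ↥(Λ r K s) × Fin 3 ≃ Fin (m₀ r K s)) {S : ℝ} (hS : 0 < S) (hSπ : 3 * S ^ 2 < Real.pi ^ 2)
    {F : ∀ r K (t : ℝ) s, GaugeField (P r K s) (jl r K s) SU2 → ℝ≥0∞} (hF : ∀ r K t s, Measurable (F r K t s))
    (hFi : ∀ r K t s, GaugeInvariant (F r K t s)) {u : ∀ r K (t : ℝ) s, GaugeField (P r K s) (jl r K s) SU2 → ℝ}
    (hu : ∀ r K t s, Measurable (u r K t s)) (hui : ∀ r K t s, GaugeInvariant (u r K t s)) {ιc : Bool → ℕ → σ → Type*}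
    {Pu : ∀ r K (t : ℝ) s, Finset (ιc r K s)} (hPu : ∀ r K t s, (Pu r K t s).Nonempty)
    -- the classifier's plaquettes PLACED on the fine lattice: `plq p = (x, μ, ν)` ⇒ `ℓs p :=` the four (Ad-twiste …
    (plq : ∀ r K (t : ℝ) s, ιc r K s → B7Prop1Explicit.Site (P r K s).d × Fin (P r K s).d × Fin (P r K s).d) {κN : Bool → ℕ → σ → Type*}
    (N : ∀ r K (t : ℝ) s, Finset (κN r K s)) {ιN : ∀ r K s, κN r K s → Type*} {PuN : ∀ r K (t : ℝ) s, (i : κN r K s) → Finset (ιN r K s i)}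
    (hPuN : ∀ r K t s, ∀ i, (PuN r K t s i).Nonempty) {AN : Bool → ℕ → σ → Type*} [∀ r K s, NormedRing (AN r K s)]
    [∀ r K s, NormedAlgebra ℂ (AN r K s)] [∀ r K s, CompleteSpace (AN r K s)]
    (holN : ∀ r K (t : ℝ) s, (i : κN r K s) → GaugeField (P r K s) (jl r K s) SU2 → ιN r K s i → (Fin (m₀ r K s) → ℝ) → AN r K s)
    {θN RN HN δN : ∀ r K (t : ℝ) s, κN r K s → ℝ} (hRN : ∀ r K t s, ∀ i ∈ N r K t s, 1 < RN r K t s i)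
    (hθN : ∀ r K t s, ∀ i ∈ N r K t s, 0 < θN r K t s i) (hδ0N : ∀ r K t s, ∀ i ∈ N r K t s, 0 ≤ δN r K t s i)
    (hδ1N : ∀ r K t s, ∀ i ∈ N r K t s, δN r K t s i ≤ 1)
    (hSMN : ∀ r K t s, ∀ i ∈ N r K t s, 36 * HN r K t s i * 1 ^ 2 / (RN r K t s i - 1) ^ 2 ≤ δN r K t s i * θN r K t s i)
    (hANN : ∀ r K t s, ∀ i ∈ N r K t s, ∀ V, ∀ x ∈ closedBall (0 : Fin (m₀ r K s) → ℝ) S, ∀ p ∈ PuN r K t s i, ∃ f : ℂ → AN r K s, DifferentiableOn ℂ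
      f (ball 0 (RN r K t s i)) ∧ (∀ w ∈ ball (0 : ℂ) (RN r K t s i), ‖f w‖ ≤ HN r K t s i) ∧ f 0 = 0 ∧ ∀ c : ℝ, 0 ≤ c → c ≤ 1 → f (c : ℂ) = holN r K
      t s i V p (c • x) - 1)
    {δ : ℝ}
    -- ══ ROW S109 (R-ne7cp1-g36-12 (4)): the u-tuple's carrier READ as the (19)∕(98) source space on the block's …
    (Λu : ∀ r K (t : ℝ) s, Finset (B7Prop1Explicit.Site (P r K s).d × Fin (P r K s).d))
    (U₀u : ∀ r K (t : ℝ) s, B7Prop1Explicit.Site (P r K s).d → Fin (P r K s).d → (Matrix n n ℂ)ˣ)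
    (hU₀u : ∀ r K t s, ∀ y κ, U₀u r K t s y κ ∈ U1 (Matrix n n ℂ)) (wu : ∀ r K t s, ↥(Λu r K t s) → ℝ) (wu' : ∀ r K t s, ↥(covIdx (Λu r K t s)) → ℝ)
    [∀ r K t s, Fact (∀ b, 0 < wu r K t s b)] [∀ r K t s, Fact (∀ i, 0 < wu' r K t s i)] {w₀ w₀' : ℝ} (hw₀ : 0 < w₀) (hw₀' : 0 < w₀')
    (hfl : ∀ r K t s, ∀ b, w₀ ≤ wu r K t s b) (hfl' : ∀ r K t s, ∀ i, w₀' ≤ wu' r K t s i)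
    (𝒢 : ∀ r K t s, GaugeField (P r K s) (jl r K s) SU2 → (𝒵 r K s →L[ℂ] (Ysp (Λu r K t s) (η r (jl r K s)) (U₀u r K t s) (wu r K t s) (wu' r K t
      s))))
    (W𝒱 : ∀ r K t s, GaugeField (P r K s) (jl r K s) SU2 → (Ysp (Λu r K t s) (η r (jl r K s)) (U₀u r K t s) (wu r K t s) (wu' r K t s)) → 𝒵 r K s)
    {B₀ C₄ a₃ ε₄ : ℝ} (h𝒢 : ∀ r K t s, ∀ V f, ‖𝒢 r K t s V f‖ ≤ B₀ * ‖f‖) (hW : ∀ r K t s, ∀ V, Prop4Hyp (W𝒱 r K t s V) C₄ a₃) (hB₀ : 0 < B₀)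
    (hC₄ : 0 ≤ C₄) (hε₄ : 0 ≤ ε₄) {dL C₁ B₃ ε₁ : ℝ} (hdL : 0 ≤ dL) (hC₁ : 0 ≤ C₁) (hε₁ : 0 ≤ ε₁) (hB₃ : dL ≤ B₃) (h1 : 2 * B₀ * C₁ * B₃ * ε₁ ≤ ε₄)
    (h2 : 4 * ε₄ ≤ a₃) (h3 : 16 * B₀ * C₄ * ε₄ ≤ 1)
    (H₁ : ∀ r K t s, GaugeField (P r K s) (jl r K s) SU2 → (ℬ r K s →L[ℂ] (Ysp (Λu r K t s) (η r (jl r K s)) (U₀u r K t s) (wu r K t s) (wu' r K t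
      s))))
    (hH₁ : ∀ r K t s, ∀ V B, ‖H₁ r K t s V B‖ ≤ B₀ * ‖B‖)
    (TΦ : ∀ r K (t : ℝ) s, GaugeField (P r K s) (jl r K s) SU2 → ((Fin (m₀ r K s) → ℂ) →L[ℂ] (ℬ r K s))) {rΦ : ℝ}
    (hTb : ∀ r K t s, ∀ V, ‖TΦ r K t s V‖ * rΦ < 2 * dL * C₁ * ε₁) (hSr : S < rΦ) (k : Bool → ℕ → σ → ℕ)
    (Sf Sf' Sw Sw' : ∀ r K s, Finset (B7Prop1Explicit.Site (P r K s).d × Fin (P r K s).d))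
    (Ubg : ∀ r K (t : ℝ) s, GaugeField (P r K s) (jl r K s) SU2 → B7Prop1Explicit.Site (P r K s).d → Fin (P r K s).d → (𝔸 r K s)ˣ)
    (hUbg : ∀ r K t s, ∀ V x κ, Ubg r K t s V x κ ∈ unitaryUnits (𝔸 r K s)) {α₀ : ℝ} (hα : 0 < α₀) (hα3 : ∀ r K s, C0 (P r K s).d * α₀ ≤ 1 / 3)
    (hα4 : ∀ r K s, 4 * α₀ ≤ c2' (P r K s).d (P r K s).L) (hα6 : ∀ r K s, 4 * O1cov (P r K s).d * α₀ ≤ 1 / 3)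
    (h52locw : ∀ r K t s, ∀ V (c : ↥(Sw' r K s)), pdevOn (loK (P r K s).L (k r K s) c.1.1) (bondHiK (P r K s).L (k r K s) c.1.1 c.1.2) (Ubg r K t s V)
      < α₀ * ((((P r K s).L : ℝ) ^ k r K s)⁻¹) ^ 2)
    (ιs : ∀ r K t s, GaugeField (P r K s) (jl r K s) SU2 → ((Ysp (Λu r K t s) (η r (jl r K s)) (U₀u r K t s) (wu r K t s) (wu' r K t s)) →L[ℂ] (↥(Sf r
      K s) → 𝔸 r K s)))
    (hι : ∀ r K t s, ∀ V Y, ‖ιs r K t s V Y‖ ≤ ‖Y‖)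
    (Hop : ∀ r K t s, GaugeField (P r K s) (jl r K s) SU2 → ((↥(Sf' r K s) → 𝔸 r K s) →L[ℂ] (Ysp (Λu r K t s) (η r (jl r K s)) (U₀u r K t s) (wu r K t
      s) (wu' r K t s))))
    (hH : ∀ r K t s, ∀ V X, ‖Hop r K t s V X‖ ≤ B₀ * ‖X‖) {ε₃ : ℝ} (h18 : ∀ r K s, 18 * C2cov (P r K s).d * B₀ * ε₃ ≤ 1)
    (hcoup : ε₄ + B₀ * (2 * dL * C₁ * ε₁) ≤ ε₃) (h3R : ∀ r K s, 3 * ε₃ ≤ landauRad (P r K s).d (P r K s).L) {Λw Λz Λb : Bool → ℕ → σ → Type*}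
    [∀ r K s, Fintype (Λw r K s)] [∀ r K s, DecidableEq (Λw r K s)] [∀ r K s, Fintype (Λz r K s)] [∀ r K s, Fintype (Λb r K s)]
    {𝔄w ℭ 𝔇 : Bool → ℕ → σ → Type*} [∀ r K s, NormedAddCommGroup (𝔄w r K s)] [∀ r K s, NormedSpace ℂ (𝔄w r K s)] [∀ r K s, CompleteSpace (𝔄w r K s)]
    [∀ r K s, NormedAddCommGroup (ℭ r K s)] [∀ r K s, NormedSpace ℂ (ℭ r K s)] [∀ r K s, NormedAddCommGroup (𝔇 r K s)]
    [∀ r K s, NormedSpace ℂ (𝔇 r K s)] {δw : ℝ} (hδw : 0 ≤ δw) {Nc : Bool → ℕ → σ → ℕ} [∀ r K s, NeZero (Nc r K s)]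
    (Bref : ∀ r K (t : ℝ) s, Finset (TPt (P r K s).d (Nc r K s))) (hBref : ∀ r K t s, (Bref r K t s).Nonempty)
    (pos : ∀ r K (t : ℝ) s, Λw r K s → TPt (P r K s).d (Nc r K s)) (posz : ∀ r K (t : ℝ) s, Λz r K s → TPt (P r K s).d (Nc r K s))
    (pos' : ∀ r K (t : ℝ) s, ↥(Sw r K s) → TPt (P r K s).d (Nc r K s)) (posx : ∀ r K (t : ℝ) s, ↥(Sw' r K s) → TPt (P r K s).d (Nc r K s))
    (posb : ∀ r K (t : ℝ) s, Λb r K s → TPt (P r K s).d (Nc r K s)) {multw multz multx multb : ℕ}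
    (hmultw : ∀ r K t s, ∀ x, (Finset.univ.filter fun b' => pos r K t s b' = x).card ≤ multw)
    (hmultz : ∀ r K t s, ∀ x, (Finset.univ.filter fun b' => posz r K t s b' = x).card ≤ multz)
    (hmultx : ∀ r K t s, ∀ x, (Finset.univ.filter fun b' => posx r K t s b' = x).card ≤ multx)
    (hmultb : ∀ r K t s, ∀ x, (Finset.univ.filter fun b' => posb r K t s b' = x).card ≤ multb)
    (k𝒢 : ∀ r K (t : ℝ) s, GaugeField (P r K s) (jl r K s) SU2 → Λw r K s → Λz r K s → (ℭ r K s →L[ℂ] (𝔄w r K s)))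
    (kι : ∀ r K (t : ℝ) s, GaugeField (P r K s) (jl r K s) SU2 → ↥(Sw r K s) → Λw r K s → (𝔄w r K s →L[ℂ] (𝔸 r K s)))
    (kH : ∀ r K (t : ℝ) s, GaugeField (P r K s) (jl r K s) SU2 → Λw r K s → ↥(Sw' r K s) → (𝔸 r K s →L[ℂ] (𝔄w r K s)))
    (kH₁ : ∀ r K (t : ℝ) s, GaugeField (P r K s) (jl r K s) SU2 → Λw r K s → Λb r K s → (𝔇 r K s →L[ℂ] (𝔄w r K s)))
    {c𝒢 δ𝒢 M𝒢 cι δι Mι cH δH MH cH₁ δH₁ MH₁ : ℝ} (hc𝒢 : 0 ≤ c𝒢)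
    (hk𝒢 : ∀ r K t s, ∀ V c b', ‖k𝒢 r K t s V c b'‖ ≤ c𝒢 * Real.exp (-(δ𝒢 * pl1 (pos r K t s c - posz r K t s b')))) (hgap𝒢 : δw < δ𝒢)
    (hM𝒢c : ∀ r K s, (multz : ℝ) * (2 * (((P r K s).d : ℝ) + (δ𝒢 - δw)) / (δ𝒢 - δw)) ^ (P r K s).d ≤ M𝒢) (hcι : 0 ≤ cι)
    (hkι : ∀ r K t s, ∀ V c b', ‖kι r K t s V c b'‖ ≤ cι * Real.exp (-(δι * pl1 (pos' r K t s c - pos r K t s b')))) (hgapι : δw < δι)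
    (hMιc : ∀ r K s, (multw : ℝ) * (2 * (((P r K s).d : ℝ) + (δι - δw)) / (δι - δw)) ^ (P r K s).d ≤ Mι) (hcH : 0 ≤ cH)
    (hkH : ∀ r K t s, ∀ V c b', ‖kH r K t s V c b'‖ ≤ cH * Real.exp (-(δH * pl1 (pos r K t s c - posx r K t s b')))) (hgapH : δw < δH)
    (hMHc : ∀ r K s, (multx : ℝ) * (2 * (((P r K s).d : ℝ) + (δH - δw)) / (δH - δw)) ^ (P r K s).d ≤ MH) (hcH₁ : 0 ≤ cH₁)
    (hkH₁ : ∀ r K t s, ∀ V c b', ‖kH₁ r K t s V c b'‖ ≤ cH₁ * Real.exp (-(δH₁ * pl1 (pos r K t s c - posb r K t s b')))) (hgapH₁ : δw < δH₁)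
    (hMH₁c : ∀ r K s, (multb : ℝ) * (2 * (((P r K s).d : ℝ) + (δH₁ - δw)) / (δH₁ - δw)) ^ (P r K s).d ≤ MH₁)
    (W𝒱w : ∀ r K (t : ℝ) s, GaugeField (P r K s) (jl r K s) SU2 → (Λw r K s → 𝔄w r K s) → (Λz r K s → ℭ r K s)) {B₀w C₄w a₃w ε₄w bw : ℝ}
    (hWw : ∀ r K t s, ∀ V, Prop4Hyp (W𝒱w r K t s V) C₄w a₃w) (hB₀w : 0 < B₀w) (hC₄w : 0 ≤ C₄w) (hε₄w : 0 ≤ ε₄w) (hdomw : 2 * (ε₄w + B₀w * bw) ≤ a₃w)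
    (hselfw : B₀w * C₄w * (ε₄w + B₀w * bw) ^ 2 ≤ ε₄w) (hcontrw : 4 * B₀w * C₄w * (ε₄w + B₀w * bw) < 1)
    (Tw : ∀ r K (t : ℝ) s, GaugeField (P r K s) (jl r K s) SU2 → ((Fin (m₀ r K s) → ℂ) →L[ℂ] (Λb r K s → 𝔇 r K s))) {rΦw : ℝ}
    (hTbw : ∀ r K t s, ∀ V, ‖Tw r K t s V‖ * rΦw < bw) (h2Sw : 2 * S ≤ rΦw) (hιw : ∀ r K t s, ∀ V Y, ‖kerOp (kι r K t s V) Y‖ ≤ ‖Y‖)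
    (hqw : ∀ r K s, 9 * C2cov (P r K s).d * B₀w * (ε₄w + B₀w * bw) < 1) (hRCw : ∀ r K s, 6 * (ε₄w + B₀w * bw) ≤ landauRad (P r K s).d (P r K s).L)
    (NW : ∀ r K (t : ℝ) s, Λz r K s → Λw r K s → Prop)
    (hlocW : ∀ r K t s, ∀ V, ∀ A A' : Λw r K s → 𝔄w r K s, ∀ c', (∀ b', NW r K t s c' b' → A b' = A' b') → W𝒱w r K t s V A c' = W𝒱w r K t s V A' c')
    {rW : ℝ}
    (hreachW : ∀ r K t s, ∀ c' b', NW r K t s c' b' → pinDist (Bref r K t s) (hBref r K t s) (posz r K t s c') - rW ≤ pinDist (Bref r K t s) (hBref r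
      K t s) (pos r K t s b'))
    {rC : ℝ}
    (hreachC : ∀ r K t s, ∀ (c' : ↥(Sw' r K s)) (b' : ↥(Sw r K s)), BondIn (loK (P r K s).L (k r K s) c'.1.1) (bondHiK (P r K s).L (k r K s) c'.1.1
      c'.1.2) b'.1.1 b'.1.2 → pinDist (Bref r K t s) (hBref r K t s) (posx r K t s c') - rC ≤ pinDist (Bref r K t s) (hBref r K t s) (pos' r K t s
      b'))
    (hsupp : ∀ r K t s, ∀ V, ∀ z : Fin (m₀ r K s) → ℂ, ∀ i, 0 < pinDist (Bref r K t s) (hBref r K t s) (posb r K t s i) → Tw r K t s V z i = 0)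
    (hqW : c𝒢 * M𝒢 * (4 * C₄w * (ε₄w + B₀w * bw) * Real.exp (δw * rW)) < 1)
    (hk : ∀ r K s, 12 * C2cov (P r K s).d * (ε₄w + B₀w * bw) * Real.exp (δw * rC) * (cι * Mι) * (cH * MH) < 1) {𝔭 : Bool → ℕ → σ → Type*}
    (Pw : ∀ r K (t : ℝ) s, Finset (𝔭 r K s)) (ℓw : ∀ r K (t : ℝ) s, 𝔭 r K s → List ((Λw r K s → 𝔄w r K s) →L[ℂ] Matrix n n ℂ))
    (suppw : ∀ r K (t : ℝ) s, 𝔭 r K s → Finset (Λw r K s)) (ϖPw : ∀ r K (t : ℝ) s, 𝔭 r K s → ℝ)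
    (hblindw : ∀ r K t s, ∀ p ∈ Pw r K t s, ∀ ℓ ∈ ℓw r K t s p, ∀ A A' : Λw r K s → 𝔄w r K s, (∀ b' ∈ suppw r K t s p, A b' = A' b') → ℓ A = ℓ A')
    (hdepthw : ∀ r K t s, ∀ p ∈ Pw r K t s, ∀ b' ∈ suppw r K t s p, ϖPw r K t s p ≤ pinDist (Bref r K t s) (hBref r K t s) (pos r K t s b'))
    (hϖPw : ∀ r K t s, ∀ p ∈ Pw r K t s, 0 ≤ ϖPw r K t s p) {κwb κcb : Bool → ℕ → ℝ} (hκwb : ∀ r K s, 0 ≤ κwb r (jl r K s))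
    (hκcb : ∀ r K s, 0 ≤ κcb r (jl r K s)) (hℓwb : ∀ r K t s, ∀ p ∈ Pw r K t s, ∀ ℓ ∈ ℓw r K t s p, ‖ℓ‖ ≤ κwb r (jl r K s))
    (hcurlw : ∀ r K t s, ∀ p ∈ Pw r K t s, ‖(ℓw r K t s p).sum‖ ≤ κcb r (jl r K s)) {mw : ℕ}
    (hlenw : ∀ r K t s, ∀ p ∈ Pw r K t s, (ℓw r K t s p).length ≤ mw) (𝓡𝒴w : ∀ r K (t : ℝ) s, AddSubgroup (Λw r K s → 𝔄w r K s))
    (h𝓡𝒴w : ∀ r K t s, IsClosed (𝓡𝒴w r K t s : Set (Λw r K s → 𝔄w r K s))) (𝓡𝒵w : ∀ r K (t : ℝ) s, AddSubgroup (Λz r K s → ℭ r K s))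
    (𝓡ℬw : ∀ r K (t : ℝ) s, AddSubgroup (Λb r K s → 𝔇 r K s)) (h𝒢rw : ∀ r K t s, ∀ V, ∀ f ∈ 𝓡𝒵w r K t s, kerOp (k𝒢 r K t s V) f ∈ 𝓡𝒴w r K t s)
    (hWrw : ∀ r K t s, ∀ V, ∀ Y ∈ 𝓡𝒴w r K t s, W𝒱w r K t s V Y ∈ 𝓡𝒵w r K t s)
    (hιrw : ∀ r K t s, ∀ V, ∀ Y ∈ 𝓡𝒴w r K t s, kerOp (kι r K t s V) Y ∈ skewPi ↥(Sw r K s))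
    (hHrw : ∀ r K t s, ∀ V, ∀ X ∈ skewPi (𝔸 := 𝔸 r K s) ↥(Sw' r K s), kerOp (kH r K t s V) X ∈ 𝓡𝒴w r K t s)
    (hH₁rw : ∀ r K t s, ∀ V, ∀ B ∈ 𝓡ℬw r K t s, kerOp (kH₁ r K t s V) B ∈ 𝓡𝒴w r K t s)
    (hTrw : ∀ r K t s, ∀ V (y : Fin (m₀ r K s) → ℝ), Tw r K t s V (cplx y) ∈ 𝓡ℬw r K t s)
    (hskew : ∀ r K t s, ∀ p ∈ Pw r K t s, ∀ ℓ ∈ ℓw r K t s p, ∀ Y ∈ 𝓡𝒴w r K t s, ℓ Y ∈ skewAdjoint (Matrix n n ℂ))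
    (Bp : ∀ r K (t : ℝ) s, GaugeField (P r K s) (jl r K s) SU2 → 𝔭 r K s → Matrix n n ℂ) {d : ∀ r K (t : ℝ) s, 𝔭 r K s → ℝ} {dbar : Bool → ℕ → ℝ}
    (hBu : ∀ r K t s, ∀ V, ∀ p ∈ Pw r K t s, Bp r K t s V p ∈ unitary (Matrix n n ℂ))
    (hBd : ∀ r K t s, ∀ V, ∀ p ∈ Pw r K t s, ‖Bp r K t s V p - 1‖ ≤ d r K t s p) (hd : ∀ r K t s, ∀ p ∈ Pw r K t s, d r K t s p ≤ dbar r (jl r K s))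
    (hdbar : ∀ r K s, 0 ≤ dbar r (jl r K s)) {Kw : Bool → ℕ → ℝ}
    (hKw : ∀ r K t s, ∑ p ∈ Pw r K t s, Real.exp (-(δw * ϖPw r K t s p)) ≤ Kw r (jl r K s)) (hB𝒢w : c𝒢 * M𝒢 ≤ B₀w) (hBH₁w : cH₁ * MH₁ ≤ B₀w)
    (hBHw : cH * MH ≤ B₀w) {ε₄e : ℝ} (hε₄e : 0 ≤ ε₄e) (hdome : 2 * (ε₄e + B₀w * bw) ≤ a₃w)
    (hselfe : B₀w * (C₄w * Real.exp (δw * rW)) * (ε₄e + B₀w * bw) ^ 2 ≤ ε₄e) (hcontre : 4 * B₀w * (C₄w * Real.exp (δw * rW)) * (ε₄e + B₀w * bw) < 1)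
    (hιew : ∀ r K t s, ∀ V, ∀ Y : WSup (pinW δw ((pinDist (Bref r K t s) (hBref r K t s)) ∘ (pos r K t s))) 1 (𝔄w r K s), ‖kerOpPin (kι r K t s V) δw
      ((pinDist (Bref r K t s) (hBref r K t s)) ∘ (pos r K t s)) ((pinDist (Bref r K t s) (hBref r K t s)) ∘ (pos' r K t s)) Y‖ ≤ ‖Y‖)
    (hqe : ∀ r K s, 9 * (C2cov (P r K s).d * Real.exp (2 * δw * rC)) * B₀w * (ε₄e + B₀w * bw) < 1)
    (hRCe : ∀ r K s, 3 * (ε₄e + B₀w * bw) ≤ landauRad (P r K s).d (P r K s).L) {𝔱 : Bool → ℕ → σ → Type*} (I : ∀ r K (t : ℝ) s, Finset (𝔱 r K s))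
    {Ef : ∀ r K (t : ℝ) s, 𝔱 r K s → (Λw r K s → 𝔄w r K s) → ℂ} {rE : ℝ} {ee : ∀ r K (t : ℝ) s, 𝔱 r K s → ℝ} (hrE : 0 < rE)
    (hEd : ∀ r K t s, ∀ i ∈ I r K t s, DifferentiableOn ℂ (Ef r K t s i) (ball 0 rE))
    (hEb : ∀ r K t s, ∀ i ∈ I r K t s, ∀ Z ∈ ball (0 : Λw r K s → 𝔄w r K s) rE, ‖Ef r K t s i Z‖ ≤ ee r K t s i)
    (supp : ∀ r K (t : ℝ) s, 𝔱 r K s → Finset (Λw r K s))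
    (hblind : ∀ r K t s, ∀ i ∈ I r K t s, ∀ A₁ A₂ : Λw r K s → 𝔄w r K s, (∀ b' ∈ supp r K t s i, A₁ b' = A₂ b') → Ef r K t s i A₁ = Ef r K t s i A₂)
    (ϖP : ∀ r K (t : ℝ) s, 𝔱 r K s → ℝ)
    (hdepth : ∀ r K t s, ∀ i ∈ I r K t s, ∀ b' ∈ supp r K t s i, ϖP r K t s i ≤ (pinDist (Bref r K t s) (hBref r K t s)) (pos r K t s b')) {LK : ℝ}
    (hK : ∀ r K t s, ∑ i ∈ I r K t s, 2 * ee r K t s i / rE * Real.exp (-(δw * ϖP r K t s i)) ≤ LK)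
    (hcoupE : ∀ r K s, ((ε₄e + B₀w * bw) + B₀w * (4 * (C2cov (P r K s).d * Real.exp (2 * δw * rC)) * (ε₄e + B₀w * bw) ^ 2)) ≤ rE / 2)
    {Ω : Bool → ℕ → σ → Type*} [∀ r K s, MeasurableSpace (Ω r K s)] (μ : ∀ r K (t : ℝ) s, Measure (Ω r K s)) {g : ∀ r K (t : ℝ) s, Ω r K s → ℝ}
    (hg : ∀ r K t s, ∀ ω, 0 ≤ g r K t s ω) (Aex : ∀ r K (t : ℝ) s, GaugeField (P r K s) (jl r K s) SU2 → (Fin (m₀ r K s) → ℝ) → Ω r K s → ℝ) {Bd : ℝ}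
    (hint : ∀ r K t s, ∀ V, ∀ x ∈ closedBall (0 : Fin (m₀ r K s) → ℝ) S, ∀ c : ℝ, 1 / 2 ≤ c → c ≤ 1 → Integrable (fun ω => g r K t s ω * Real.exp (Aex
      r K t s V (c • x) ω)) (μ r K t s))
    (hpos : ∀ r K t s, ∀ V, ∀ x ∈ closedBall (0 : Fin (m₀ r K s) → ℝ) S, ∀ c : ℝ, 1 / 2 ≤ c → c ≤ 1 → 0 < ∫ ω, g r K t s ω * Real.exp (Aex r K t s V
      (c • x) ω) ∂(μ r K t s))
    (hA : ∀ r K t s, ∀ V, ∀ x ∈ closedBall (0 : Fin (m₀ r K s) → ℝ) S, ∀ c : ℝ, 1 / 2 ≤ c → c ≤ 1 → ∀ ω, Aex r K t s V x ω ≤ Aex r K t s V (c • x) ω +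
      (1 - c) * Bd)
    {BE₂ : ℝ}
    (hElb₂ : ∀ r K t s, ∀ V (y : Fin (m₀ r K s) → ℝ), ‖y‖ ≤ S → -BE₂ ≤ (-Real.log (∫ ω, g r K t s ω * Real.exp (Aex r K t s V y ω) ∂(μ r K t s))))
    (L : ∀ r K t s, Set ((Ysp (Λu r K t s) (η r (jl r K s)) (U₀u r K t s) (wu r K t s) (wu' r K t s)) →L[ℂ] Matrix n n ℂ))
    (𝓡𝒵 : ∀ r K (t : ℝ) s, AddSubgroup (𝒵 r K s)) (𝓡ℬ : ∀ r K (t : ℝ) s, AddSubgroup (ℬ r K s))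
    (h𝒢r : ∀ r K t s, ∀ V, ∀ f ∈ 𝓡𝒵 r K t s, 𝒢 r K t s V f ∈ readOutReal (L r K t s))
    (hWr : ∀ r K t s, ∀ V, ∀ Y ∈ readOutReal (L r K t s), W𝒱 r K t s V Y ∈ 𝓡𝒵 r K t s)
    (hιr : ∀ r K t s, ∀ V, ∀ Y ∈ readOutReal (L r K t s), ιs r K t s V Y ∈ skewPi ↥(Sf r K s))
    (hHr : ∀ r K t s, ∀ V, ∀ X ∈ skewPi (𝔸 := 𝔸 r K s) ↥(Sf' r K s), Hop r K t s V X ∈ readOutReal (L r K t s))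
    (hH₁r : ∀ r K t s, ∀ V, ∀ B ∈ 𝓡ℬ r K t s, H₁ r K t s V B ∈ readOutReal (L r K t s))
    (hTr : ∀ r K t s, ∀ V (y : Fin (m₀ r K s) → ℝ), TΦ r K t s V (cplx y) ∈ 𝓡ℬ r K t s)
    (hudict : ∀ r K t s, ∀ V, ∀ x ∈ cube (m₀ r K s) S, u r K t s (fixTo (combBonds (lo r K s) (hi r K s)) 1 (updateFinset V (Λ r K s) (expFibreChart
      (Λ r K s) 1 (e r K s) x))) = classifier (hPu r K t s) (fun p => holOf (plaqReadOuts (Λu r K t s) (η r (jl r K s)) (U₀u r K t s) (wu r K t s)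
      (wu' r K t s) (plq r K t s p).1 (plq r K t s p).2.1 (plq r K t s p).2.2) (fun y => landauExp ((ball (0 : ↥(Sf r K s) → 𝔸 r K s) (landauRad (P r
      K s).d (P r K s).L)).indicator (landauCf (P r K s).L (1 : B7Prop1Explicit.Site (P r K s).d → Fin (P r K s).d → (𝔸 r K s)ˣ) (k r K s) (Sf r K s)
      (Sf' r K s))) (ιs r K t s V) (Hop r K t s V) (4 * C2cov (P r K s).d * (ε₄ + B₀ * (2 * dL * C₁ * ε₁)) ^ 2) (solAt (𝒢 r K t s V) 0 (W𝒱 r K t s V)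
      ε₄ (0 : 𝒵 r K s) (H₁ r K t s V (TΦ r K t s V (cplx y))) + H₁ r K t s V (TΦ r K t s V (cplx y))))) x)
    (hRdict : ∀ r K t s, ∀ V, ∀ x ∈ cube (m₀ r K s) S, F r K t s (fixTo (combBonds (lo r K s) (hi r K s)) 1 (updateFinset V (Λ r K s) (expFibreChart
      (Λ r K s) 1 (e r K s) x))) = (closedBall (0 : Fin (m₀ r K s) → ℝ) S ∩ ⋂ i ∈ N r K t s, {y | classifier (hPuN r K t s i) (holN r K t s i V) y <
      θN r K t s i}).indicator (1 : (Fin (m₀ r K s) → ℝ) → ℝ≥0∞) x * ENNReal.ofReal (Real.exp (-((∑ p ∈ Pw r K t s, β r (jl r K s) * (1 -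
      (Matrix.trace (Bp r K t s V p * holOf (ℓw r K t s p) (fun y => landauExp (landauCfBox (P r K s).L (Ubg r K t s V) (k r K s) (Sw r K s) (Sw' r K
      s) (landauRad (P r K s).d (P r K s).L)) (kerOp (kι r K t s V)) (kerOp (kH r K t s V)) (4 * C2cov (P r K s).d * (ε₄w + B₀w * bw) ^ 2) (solAt
      (kerOp (k𝒢 r K t s V)) 0 (W𝒱w r K t s V) ε₄w (0 : Λz r K s → ℭ r K s) (kerOp (kH₁ r K t s V) (Tw r K t s V (cplx y))) + kerOp (kH₁ r K t s V)
      (Tw r K t s V (cplx y)))) x)).re / Fintype.card n)) + ((∑ i ∈ I r K t s, Ef r K t s i (WSup.toPiL (pinW δw ((pinDist (Bref r K t s) (hBref r K t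
      s)) ∘ (pos r K t s))) 1 (landauExp (fun Y : WSup (pinW δw ((pinDist (Bref r K t s) (hBref r K t s)) ∘ (pos' r K t s))) 1 (𝔸 r K s) => ((toPiL
      (pinW δw ((pinDist (Bref r K t s) (hBref r K t s)) ∘ (posx r K t s))) 1).symm (landauCfBox (P r K s).L (Ubg r K t s V) (k r K s) (Sw r K s) (Sw'
      r K s) (landauRad (P r K s).d (P r K s).L) (toPiL (pinW δw ((pinDist (Bref r K t s) (hBref r K t s)) ∘ (pos' r K t s))) 1 Y)) : WSup (pinW δw
      ((pinDist (Bref r K t s) (hBref r K t s)) ∘ (posx r K t s))) 1 (𝔸 r K s))) (kerOpPin (kι r K t s V) δw ((pinDist (Bref r K t s) (hBref r K t s))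
      ∘ (pos r K t s)) ((pinDist (Bref r K t s) (hBref r K t s)) ∘ (pos' r K t s))) (kerOpPin (kH r K t s V) δw ((pinDist (Bref r K t s) (hBref r K t
      s)) ∘ (posx r K t s)) ((pinDist (Bref r K t s) (hBref r K t s)) ∘ (pos r K t s))) (4 * (C2cov (P r K s).d * Real.exp (2 * δw * rC)) * (ε₄e + B₀w
      * bw) ^ 2) (solAt (kerOpPin (k𝒢 r K t s V) δw ((pinDist (Bref r K t s) (hBref r K t s)) ∘ (posz r K t s)) ((pinDist (Bref r K t s) (hBref r K t
      s)) ∘ (pos r K t s))) 0 (fun Y : WSup (pinW δw ((pinDist (Bref r K t s) (hBref r K t s)) ∘ (pos r K t s))) 1 (𝔄w r K s) => ((toPiL (pinW δw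
      ((pinDist (Bref r K t s) (hBref r K t s)) ∘ (posz r K t s))) 1).symm (W𝒱w r K t s V (toPiL (pinW δw ((pinDist (Bref r K t s) (hBref r K t s)) ∘
      (pos r K t s))) 1 Y)) : WSup (pinW δw ((pinDist (Bref r K t s) (hBref r K t s)) ∘ (posz r K t s))) 1 (ℭ r K s))) ε₄e (0 : WSup (pinW δw
      ((pinDist (Bref r K t s) (hBref r K t s)) ∘ (posz r K t s))) 1 (ℭ r K s)) (kerOpPin (kH₁ r K t s V) δw ((pinDist (Bref r K t s) (hBref r K t s))
      ∘ (posb r K t s)) ((pinDist (Bref r K t s) (hBref r K t s)) ∘ (pos r K t s)) ((toPiL (pinW δw ((pinDist (Bref r K t s) (hBref r K t s)) ∘ (posb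
      r K t s))) 1).symm (Tw r K t s V (cplx x)))) + kerOpPin (kH₁ r K t s V) δw ((pinDist (Bref r K t s) (hBref r K t s)) ∘ (posb r K t s)) ((pinDist
      (Bref r K t s) (hBref r K t s)) ∘ (pos r K t s)) ((toPiL (pinW δw ((pinDist (Bref r K t s) (hBref r K t s)) ∘ (posb r K t s))) 1).symm (Tw r K t
      s V (cplx x))))))).re + (-Real.log (∫ ω, g r K t s ω * Real.exp (Aex r K t s V x ω) ∂(μ r K t s))))))))
    (hδ0 : 0 ≤ δ) (hδ1 : δ < 1) {c₁ c₂ zs : ℝ}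
    -- (SM) IN η-FREE NUMBERS (S109 f1 `smRows_of_etaFree`; ROW S95's LIFT RULE): with `κr := η∕w₀`, `κc := 2η²∕w₀ …
    (hη1 : ∀ r K s, η r (jl r K s) ≤ 1)
    (hs₁' : ∀ r K s, 2 * ((ε₄ + B₀ * (2 * dL * C₁ * ε₁)) + B₀ * (4 * C2cov (P r K s).d * (ε₄ + B₀ * (2 * dL * C₁ * ε₁)) ^ 2)) ≤ c₁ * w₀' ^ 2 * zs)
    (ha' : ∀ r K s, ((ε₄ + B₀ * (2 * dL * C₁ * ε₁)) + B₀ * (4 * C2cov (P r K s).d * (ε₄ + B₀ * (2 * dL * C₁ * ε₁)) ^ 2)) ≤ c₂ * w₀ * zs)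
    (hma' : ∀ r K s, 4 * ((ε₄ + B₀ * (2 * dL * C₁ * ε₁)) + B₀ * (4 * C2cov (P r K s).d * (ε₄ + B₀ * (2 * dL * C₁ * ε₁)) ^ 2)) ≤ w₀)
    (hsm : ∀ r K s, 36 * (c₁ * zs + (4 : ℕ) ^ 2 * c₂ ^ 2 * zs ^ 2) / (rΦ / S - 1) ^ 2 ≤ δ * ε r (K - lvl r K s)) {a : ℝ} (ha0 : 0 ≤ a)
    (hrad : ∀ r K s, (((P r K s).d - 1 : ℕ) : ℝ) * nb r K s * a ≤ 2 * Real.sin (S / 2))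
    {Pcore Pcollar : ∀ r K (t : ℝ) s, Set (Plaq (P r K s) (jl r K s))}
    (hcover : ∀ r K t s, boxPlaqs (lo r K s) (hi r K s) ⊆ Pcore r K t s ∪ (Pcollar r K t s))
    (hcore : ∀ r K t s, ∀ (V : GaugeField (P r K s) (jl r K s) SU2) (y : ↥(Λ r K s) → SU2), u r K t s (fixTo (combBonds (lo r K s) (hi r K s)) 1
      (updateFinset V (Λ r K s) y)) < ε r (K - lvl r K s) * η r (jl r K s) ^ 2 → PlaqSmallOn (Pcore r K t s) a (fixTo (combBonds (lo r K s) (hi r K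
      s)) 1 (updateFinset V (Λ r K s) y)))
    (hcollar : ∀ r K t s, ∀ (V : GaugeField (P r K s) (jl r K s) SU2) (y : ↥(Λ r K s) → SU2), F r K t s (fixTo (combBonds (lo r K s) (hi r K s)) 1
      (updateFinset V (Λ r K s) y)) ≠ 0 → PlaqSmallOn (Pcollar r K t s) a (fixTo (combBonds (lo r K s) (hi r K s)) 1 (updateFinset V (Λ r K s) y)))
    (hρ : ∀ r j, ρ r j ≤ (1 - δ) / 2) (hβ : ∀ r j, 0 ≤ β r j)
    :
    ∀ (r : Bool) (K : ℕ) (t : ℝ) (s : σ), SlotAntiConcentration ((fieldMeasure (P r K s) (jl r K s) SU2).withDensity (F r K t s)) (fun U => u r K t s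
      U / η r (jl r K s) ^ 2) (ε r (K - lvl r K s)) (ρ r (lvl r K s)) (2 * ((m₀ r K s : ℝ) + (3 * (|β r (jl r K s)| * ((dbar r (jl r K s) + 2 * (κcb r
      (jl r K s) * (cH₁ * MH₁ * bw / ((1 - c𝒢 * M𝒢 * (4 * C₄w * (ε₄w + B₀w * bw) * Real.exp (δw * rW))) * (1 - 12 * C2cov (P r K s).d * (ε₄w + B₀w *
      bw) * Real.exp (δw * rC) * (cι * Mι) * (cH * MH)))) + expTail₂ (mw * (κwb r (jl r K s) * (cH₁ * MH₁ * bw / ((1 - c𝒢 * M𝒢 * (4 * C₄w * (ε₄w + B₀w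
      * bw) * Real.exp (δw * rW))) * (1 - 12 * C2cov (P r K s).d * (ε₄w + B₀w * bw) * Real.exp (δw * rC) * (cι * Mι) * (cH * MH))))))) / (rΦw / S)) *
      (2 * (κcb r (jl r K s) * (cH₁ * MH₁ * bw / ((1 - c𝒢 * M𝒢 * (4 * C₄w * (ε₄w + B₀w * bw) * Real.exp (δw * rW))) * (1 - 12 * C2cov (P r K s).d *
      (ε₄w + B₀w * bw) * Real.exp (δw * rC) * (cι * Mι) * (cH * MH)))) + expTail₂ (mw * (κwb r (jl r K s) * (cH₁ * MH₁ * bw / ((1 - c𝒢 * M𝒢 * (4 * C₄w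
      * (ε₄w + B₀w * bw) * Real.exp (δw * rW))) * (1 - 12 * C2cov (P r K s).d * (ε₄w + B₀w * bw) * Real.exp (δw * rC) * (cι * Mι) * (cH * MH))))))) /
      (rΦw / S))) * Kw r (jl r K s)) + (3 * (LK * (2 * ((ε₄e + B₀w * bw) + B₀w * (4 * (C2cov (P r K s).d * Real.exp (2 * δw * rC)) * (ε₄e + B₀w * bw)
      ^ 2)))) / (rΦw / S - 1) + Bd))) / (1 - δ)) :=
  fun r K t s => slotAntiConcentration_thresholdUnits (hη r (jl r K s))
    (slotAC_realized_su2_landauChart_assembled_decay_v6_cfB7_lin_coTests_schur_elb_coarse_readOuts (hn r K s) (hN r K s) (Λ r K s) (hΛbox r K s) (hΛcomb r K s) (e r K s) hS hSπ (hF r K t s) (hFi r K t s) (hu r K t s) (hui r K t s)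
      (hPu r K t s) (plq r K t s) (N r K t s) (hPuN r K t s) (holN r K t s) (hRN r K t s) (hθN r K t s) (hδ0N r K t s) (hδ1N r K t s) (hSMN r K t s)
      (hANN r K t s) (Λu r K t s) (U₀u r K t s) (hU₀u r K t s) (wu r K t s) (wu' r K t s) hw₀ hw₀' (hfl r K t s) (hfl' r K t s) (𝒢 r K t s) (W𝒱 r K t
      s) (h𝒢 r K t s) (hW r K t s) hB₀ hC₄ hε₄ hdL hC₁ hε₁ hB₃ h1 h2 h3 (H₁ r K t s) (hH₁ r K t s) (TΦ r K t s) (hTb r K t s) hSr (k r K s) (Sf r K s)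
      (Sf' r K s) (Sw r K s) (Sw' r K s) (Ubg r K t s) (hUbg r K t s) hα (hα3 r K s) (hα4 r K s) (hα6 r K s) (h52locw r K t s) (ιs r K t s) (hι r K t
      s) (Hop r K t s) (hH r K t s) (h18 r K s) hcoup (h3R r K s) hδw (Bref r K t s) (hBref r K t s) (pos r K t s) (posz r K t s) (pos' r K t s) (posx
      r K t s) (posb r K t s) (hmultw r K t s) (hmultz r K t s) (hmultx r K t s) (hmultb r K t s) (k𝒢 r K t s) (kι r K t s) (kH r K t s) (kH₁ r K t s)
      hc𝒢 (hk𝒢 r K t s) hgap𝒢 (hM𝒢c r K s) hcι (hkι r K t s) hgapι (hMιc r K s) hcH (hkH r K t s) hgapH (hMHc r K s) hcH₁ (hkH₁ r K t s) hgapH₁ (hMH₁c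
      r K s) (W𝒱w r K t s) (hWw r K t s) hB₀w hC₄w hε₄w hdomw hselfw hcontrw (Tw r K t s) (hTbw r K t s) h2Sw (hιw r K t s) (hqw r K s) (hRCw r K s)
      (NW r K t s) (hlocW r K t s) (hreachW r K t s) (hreachC r K t s) (hsupp r K t s) hqW (hk r K s) (Pw r K t s) (ℓw r K t s) (suppw r K t s) (ϖPw r
      K t s) (hblindw r K t s) (hdepthw r K t s) (hϖPw r K t s) (hκwb r K s) (hκcb r K s) (hℓwb r K t s) (hcurlw r K t s) (hlenw r K t s) (𝓡𝒴w r K t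
      s) (h𝓡𝒴w r K t s) (𝓡𝒵w r K t s) (𝓡ℬw r K t s) (h𝒢rw r K t s) (hWrw r K t s) (hιrw r K t s) (hHrw r K t s) (hH₁rw r K t s) (hTrw r K t s) (hskew
      r K t s) (Bp r K t s) (hBu r K t s) (hBd r K t s) (hd r K t s) (hdbar r K s) (hKw r K t s) hB𝒢w hBH₁w hBHw hε₄e hdome hselfe hcontre (hιew r K t
      s) (hqe r K s) (hRCe r K s) (I r K t s) hrE (hEd r K t s) (hEb r K t s) (supp r K t s) (hblind r K t s) (ϖP r K t s) (hdepth r K t s) (hK r K t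
      s) (hcoupE r K s) (μ r K t s) (hg r K t s) (Aex r K t s) (hint r K t s) (hpos r K t s) (hA r K t s) (hElb₂ r K t s) (L r K t s) (𝓡𝒵 r K t s) (𝓡ℬ
      r K t s) (h𝒢r r K t s) (hWr r K t s) (hιr r K t s) (hHr r K t s) (hH₁r r K t s) (hTr r K t s) (hudict r K t s) (hRdict r K t s) hδ0 hδ1 (hρ0 r
      (lvl r K s)) (hρ r (lvl r K s)) (hβ r (jl r K s)) (hη r (jl r K s)) (hε r (K - lvl r K s)) (hη1 r K s) (hs₁' r K s) (ha' r K s) (hma' r K s)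
      (hsm r K s) ha0 (hrad r K s) (hcover r K t s) (hcore r K t s) (hcollar r K t s))

end Summit.QuantumFields.BalabanUV.T4Continuum.ShellMeasureLiveEndOneCallSlotLevelsCfLinJunctionV6

end
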